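import Summits.PneNP.PneNP.Theorems.ConvexRankGatesCliqueExtLowerBoundHorns
import Summits.PneNP.PneNP.Theorems.ConvexRankGatesConvexGateBlindCertificates

/-!
# The rejection functional of a CONV gate and the row-dominated sub-class
(crux `CliqueExtLowerBound`, stmt-PneNP-10682; line `width-threshold-certificate-sparsity`, leaf `stub_convWideCnf`)

A CONV gate accepts `v` iff `b + B[v] ∈ K`, `K = {z : ∃ Y ⪰ 0, tr(Aᵢ Y) ≤ zᵢ}` — convex and up-closed but not
necessarily closed. This file records the structural fact behind every analysis of the CONV leaf, with the
closedness caveat removed, and its first consequence on the referee pair: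

* `convGate_reject_lt_accept` — every REJECTED input `v₀` is strictly separated from ALL accepted inputs by ONE
  non-negative combination `y ≥ 0` of the rows: `∑ yᵢ(b + B[v₀])ᵢ < ∑ yᵢ(b + B[v])ᵢ` for every accepted `v`
  (trace bounds are free on the finite input type, `conv_exists_traceBound`; strict Farkas certificate of the
  trace-bounded rejection, `certificate_of_infeasible_traceBounded`; weak duality at the accepted input);
* `convGate_reject_imp_exists_nonneg_functional` — hence by one non-negative weighting `w = Bᵀy` of the WIRES:
  a CONV gate is the AND, over its rejected inputs, of monotone real threshold gates of its wires with weight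
  vectors in the row cone of `B`; `exists_threshold_witness_of_reject` is the composed (horn) form;
* `convGate_accept_of_dominates` — DOMINATION: `B[v] ≥ B[v₀]` row by row and `v₀` accepted ⇒ `v` accepted;
* `pair_of_rowDominated`, `convWideCnf_of_rowDominated` (leaf vocabulary) — THE ROW-DOMINATED SUB-CLASS: if all but
  `≤ ε#N` negatives dominate every positive through the rows of `B`, the gate composed with its children is
  blind on the positives or `ε`-blind on the negatives, hence has the leaf's legal local pair at every locality
  (`Horns.pair_of_blind`). Instance: degree-profile gates (…ConvDegreeProfile).

Stub-worker of lead prover seat `prover-line-stmt-PneNP-10682-c10`, 2026-08-17.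
-/

set_option linter.dupNamespace false

open Literature.Computability.Complexity Filter Finset
open Summit.PneNP.PneNP.Theorems.CliqueExtLowerBound.WidthThreshold

noncomputable section

namespace Summit.PneNP.PneNP.Theorems.CliqueExtLowerBound.WidthThreshold.ConvRowCone

open Summit.PneNP.PneNP.Theorems (conv_exists_traceBound certificate_of_infeasible_traceBounded)

/-! ## §1 The rejection functional of a CONV gate -/

/-- **Every rejection of a CONV gate is witnessed by ONE non-negative combination of its rows that
separates the rejected input from ALL accepted inputs.** For SDP-feasibility data `(A, b, B)`
representing `f` on `{0,1}ⁿ` and a rejected `v₀`, there are row multipliers `y ≥ 0` with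
`∑ yᵢ (b + B[v₀])ᵢ < ∑ yᵢ (b + B[v])ᵢ` for every accepted `v`. Proof: on the finite input type the
psd variable is WLOG trace-bounded (`conv_exists_traceBound`), so the rejection has a strict
Farkas certificate (`certificate_of_infeasible_traceBounded`), and weak duality at any accepted
input gives the strict inequality. The convex set `K = {z : ∃ Y ⪰ 0, tr(Aᵢ Y) ≤ zᵢ}` need not be
closed; the trace bound repairs this at no cost. [folklore] -/
theorem convGate_reject_lt_accept {n p q : ℕ} (A : Fin p → Matrix (Fin q) (Fin q) ℝ)
    (b : Fin p → ℝ) (B : Fin p → Fin n → ℝ) (f : (Fin n → Bool) → Bool)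
    (hf : ∀ v : Fin n → Bool, f v = true ↔ ∃ Y : Matrix (Fin q) (Fin q) ℝ, Y.PosSemidef ∧
      ∀ i, (A i * Y).trace ≤ b i + ∑ j, B i j * (if v j then (1 : ℝ) else 0))
    {v₀ : Fin n → Bool} (h₀ : f v₀ = false) :
    ∃ y : Fin p → ℝ, (∀ i, 0 ≤ y i) ∧ ∀ v : Fin n → Bool, f v = true →
      ∑ i, y i * (b i + ∑ j, B i j * (if v₀ j then (1 : ℝ) else 0)) <
        ∑ i, y i * (b i + ∑ j, B i j * (if v j then (1 : ℝ) else 0)) := by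
  set rhs : (Fin n → Bool) → Fin p → ℝ := fun v i =>
    b i + ∑ j, B i j * (if v j then (1 : ℝ) else 0) with hrhs
  obtain ⟨R, hR, hiff⟩ := conv_exists_traceBound A rhs
  have hinf : ¬ ∃ Y : Matrix (Fin q) (Fin q) ℝ, Y.PosSemidef ∧ Y.trace ≤ R ∧
      ∀ i, (A i * Y).trace ≤ rhs v₀ i := by
    intro h
    have h1 : f v₀ = true := (hf v₀).2 ((hiff v₀).2 h)
    rw [h₀] at h1
    exact Bool.false_ne_true h1
  obtain ⟨y, lam, hy, hlam, hpsd, hneg⟩ := certificate_of_infeasible_traceBounded A (rhs v₀) hR hinf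
  refine ⟨y, hy, fun v hv => ?_⟩
  obtain ⟨Y, hY, htr, hrows⟩ := (hiff v).1 ((hf v).1 hv)
  have h1 := hpsd Y hY
  have h2 : ∑ i, y i * (A i * Y).trace ≤ ∑ i, y i * rhs v i :=
    Finset.sum_le_sum fun i _ => mul_le_mul_of_nonneg_left (hrows i) (hy i)
  have h3 : lam * Y.trace ≤ lam * R := mul_le_mul_of_nonneg_left htr hlam
  show ∑ i, y i * rhs v₀ i < ∑ i, y i * rhs v i
  linarith

/-- Bookkeeping: `∑ᵢ yᵢ (bᵢ + (B[u])ᵢ) = ∑ᵢ yᵢ bᵢ + ∑ⱼ (Bᵀy)ⱼ [uⱼ]`. [folklore] -/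
theorem sum_rows_eq_sum_wires {n p : ℕ} (b : Fin p → ℝ) (B : Fin p → Fin n → ℝ) (y : Fin p → ℝ)
    (u : Fin n → Bool) :
    ∑ i, y i * (b i + ∑ j, B i j * (if u j then (1 : ℝ) else 0)) =
      ∑ i, y i * b i + ∑ j, (∑ i, y i * B i j) * (if u j then (1 : ℝ) else 0) := by
  have h : ∑ j, (∑ i, y i * B i j) * (if u j then (1 : ℝ) else 0) =
      ∑ i, ∑ j, y i * (B i j * (if u j then (1 : ℝ) else 0)) := by
    rw [Finset.sum_comm]
    refine Finset.sum_congr rfl fun j _ => ?_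
    rw [Finset.sum_mul]
    exact Finset.sum_congr rfl fun i _ => by ring
  rw [h, ← Finset.sum_add_distrib]
  refine Finset.sum_congr rfl fun i _ => ?_
  rw [mul_add, Finset.mul_sum]

/-- **The rejection functional on the wires** (the KEY STRUCTURAL FACT of the leaf, proved): for a
CONV gate with `B ≥ 0` and a rejected input `v₀` there is a NON-NEGATIVE weighting `w = Bᵀy` of the
wires — a vector of the row cone of `B` — such that `v₀` switches on strictly less `w`-weight than
EVERY accepted input: `∑ⱼ wⱼ [v₀ⱼ] < ∑ⱼ wⱼ [vⱼ]`. Equivalently: a CONV gate is the AND, over its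
rejected inputs, of monotone real threshold gates of its wires with weight vectors in the row cone
of `B`; the psd data enter only through the existence of `y`. [folklore] -/
theorem convGate_reject_imp_exists_nonneg_functional {n p q : ℕ}
    (A : Fin p → Matrix (Fin q) (Fin q) ℝ) (b : Fin p → ℝ) (B : Fin p → Fin n → ℝ)
    (hB : ∀ i j, 0 ≤ B i j) (f : (Fin n → Bool) → Bool)
    (hf : ∀ v : Fin n → Bool, f v = true ↔ ∃ Y : Matrix (Fin q) (Fin q) ℝ, Y.PosSemidef ∧
      ∀ i, (A i * Y).trace ≤ b i + ∑ j, B i j * (if v j then (1 : ℝ) else 0))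
    {v₀ : Fin n → Bool} (h₀ : f v₀ = false) :
    ∃ y : Fin p → ℝ, (∀ i, 0 ≤ y i) ∧ (∀ j, 0 ≤ ∑ i, y i * B i j) ∧ ∀ v : Fin n → Bool, f v = true →
      ∑ j, (∑ i, y i * B i j) * (if v₀ j then (1 : ℝ) else 0) <
        ∑ j, (∑ i, y i * B i j) * (if v j then (1 : ℝ) else 0) := by
  obtain ⟨y, hy, hsep⟩ := convGate_reject_lt_accept A b B f hf h₀
  refine ⟨y, hy, fun j => Finset.sum_nonneg fun i _ => mul_nonneg (hy i) (hB i j), fun v hv => ?_⟩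
  have h := hsep v hv
  rw [sum_rows_eq_sum_wires, sum_rows_eq_sum_wires] at h
  linarith

/-- **Domination** (no separation needed, only up-closedness of the feasible right-hand sides): if
`v₀` is accepted and `B[v] ≥ B[v₀]` row by row, then `v` is accepted — the same psd witness works.
This is NOT monotonicity of the gate (`v ≥ v₀` is not assumed, only `B[v] ≥ B[v₀]`). [folklore] -/
theorem convGate_accept_of_dominates {n p q : ℕ} (A : Fin p → Matrix (Fin q) (Fin q) ℝ)
    (b : Fin p → ℝ) (B : Fin p → Fin n → ℝ) (f : (Fin n → Bool) → Bool)
    (hf : ∀ v : Fin n → Bool, f v = true ↔ ∃ Y : Matrix (Fin q) (Fin q) ℝ, Y.PosSemidef ∧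
      ∀ i, (A i * Y).trace ≤ b i + ∑ j, B i j * (if v j then (1 : ℝ) else 0))
    {v₀ v : Fin n → Bool} (h₀ : f v₀ = true)
    (hdom : ∀ i, ∑ j, B i j * (if v₀ j then (1 : ℝ) else 0) ≤
      ∑ j, B i j * (if v j then (1 : ℝ) else 0)) :
    f v = true := by
  obtain ⟨Y, hY, hrows⟩ := (hf v₀).1 h₀
  exact (hf v).2 ⟨Y, hY, fun i => (hrows i).trans (by linarith [hdom i])⟩

/-! ## §2 Horn consequences: threshold witnesses and the row-dominated sub-class -/

/-- **CONV rejection is threshold rejection, in horn form.** For a CONV gate `f` composed with ANY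
valuation `val` of its wires by the edge slots (e.g. `val x j = [C j accepts x]` for local CNFs
`C j`), every rejected `y` comes with one non-negative weighting `w` of the wires (in the row cone
of `B`) such that `y` switches on strictly less `w`-weight than every accepted `x`: the set of
inputs rejected by `f ∘ val` is covered by the rejection sets of monotone real THRESHOLD gates of
the same wires, each of which accepts everything `f ∘ val` accepts. [folklore] -/
theorem exists_threshold_witness_of_reject {ι : Type} {n p q : ℕ}
    (A : Fin p → Matrix (Fin q) (Fin q) ℝ) (b : Fin p → ℝ) (B : Fin p → Fin n → ℝ)
    (hB : ∀ i j, 0 ≤ B i j) (f : (Fin n → Bool) → Bool)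
    (hf : ∀ v : Fin n → Bool, f v = true ↔ ∃ Y : Matrix (Fin q) (Fin q) ℝ, Y.PosSemidef ∧
      ∀ i, (A i * Y).trace ≤ b i + ∑ j, B i j * (if v j then (1 : ℝ) else 0))
    (val : (ι → Bool) → (Fin n → Bool)) {y : ι → Bool} (hy : f (val y) = false) :
    ∃ w : Fin n → ℝ, (∀ j, 0 ≤ w j) ∧ (∃ lam : Fin p → ℝ, (∀ i, 0 ≤ lam i) ∧
      ∀ j, w j = ∑ i, lam i * B i j) ∧
      ∀ x : ι → Bool, f (val x) = true →
        ∑ j, w j * (if val y j then (1 : ℝ) else 0) < ∑ j, w j * (if val x j then (1 : ℝ) else 0) := by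
  obtain ⟨lam, hlam, hw, hsep⟩ := convGate_reject_imp_exists_nonneg_functional A b B hB f hf hy
  exact ⟨fun j => ∑ i, lam i * B i j, hw, ⟨lam, hlam, fun j => rfl⟩, fun x hx => hsep (val x) hx⟩

open Classical in
/-- **The row-dominated sub-class is one-sidedly blind (generic pair `(P, N)`, any `ε ≥ 0`).** If all
but `≤ ε·#N` of the negatives `y` DOMINATE every positive `x ∈ P` through the rows of `B`
(`(B[val x])ᵢ ≤ (B[val y])ᵢ` for all `i`), then `f ∘ val` is blind on the positives (no positive
accepted) or `ε`-blind on the negatives (`convGate_accept_of_dominates`), hence has a legal local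
pair with both errors `≤ ε` at every locality (`Horns.pair_of_blind`). The psd data `A, b`, the
number of rows and the psd dimension are arbitrary. [folklore] -/
theorem pair_of_rowDominated {ι : Type} {n p q : ℕ}
    (A : Fin p → Matrix (Fin q) (Fin q) ℝ) (b : Fin p → ℝ) (B : Fin p → Fin n → ℝ)
    (f : (Fin n → Bool) → Bool)
    (hf : ∀ v : Fin n → Bool, f v = true ↔ ∃ Y : Matrix (Fin q) (Fin q) ℝ, Y.PosSemidef ∧
      ∀ i, (A i * Y).trace ≤ b i + ∑ j, B i j * (if v j then (1 : ℝ) else 0))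
    (val : (ι → Bool) → (Fin n → Bool)) (P N : Finset (ι → Bool)) {ε : ℝ} (hε : 0 ≤ ε)
    (hdom : (#(N.filter fun y => ¬ ∀ x ∈ P, ∀ i,
        ∑ j, B i j * (if val x j then (1 : ℝ) else 0) ≤
          ∑ j, B i j * (if val y j then (1 : ℝ) else 0)) : ℝ) ≤ ε * #N) (r s : ℕ) :
    ∃ dnf cnf : Finset (Finset ι), (∀ R ∈ dnf, #R ≤ r - 1) ∧ (∀ S ∈ cnf, #S ≤ s - 1) ∧
      (∀ x, EvalDNF dnf x → EvalCNF cnf x) ∧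
      (#(P.filter fun x => f (val x) = true ∧ ¬ EvalDNF dnf x) : ℝ) ≤ ε * #P ∧
      (#(N.filter fun x => EvalCNF cnf x ∧ f (val x) = false) : ℝ) ≤ ε * #N := by
  refine Horns.pair_of_blind (fun x => f (val x)) P N hε r s ?_
  by_cases hacc : ∃ x ∈ P, f (val x) = true
  · obtain ⟨x₀, hx₀, hfx₀⟩ := hacc
    refine Or.inr (le_trans (Nat.cast_le.2 (card_le_card fun y hy => ?_)) hdom)
    rw [mem_filter] at hy ⊢
    refine ⟨hy.1, fun hall => ?_⟩
    have := convGate_accept_of_dominates A b B f hf hfx₀ (hall x₀ hx₀)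
    rw [hy.2] at this
    exact Bool.false_ne_true this
  · left
    have : P.filter (fun x => f (val x) = true) = ∅ :=
      filter_eq_empty_iff.2 fun x hx h => hacc ⟨x, hx, h⟩
    rw [this, card_empty, Nat.cast_zero]
    positivity

open Classical in
/-- **The row-dominated sub-class, in the vocabulary of the leaf `stub_convWideCnf`** (binder-free;
PROPOSED SUB-GOAL). For every `c, m`, every gate `φ` with SDP-feasibility data `(A, b, B)` — any
number of rows, any psd dimension, any real data — and every tuple `C` of CNFs of the edge slots:
if all but `≤ #N/(8m^{c+1})` of the referee negatives dominate every bare `⌈m^{1/4}⌉₊`-clique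
through the rows of `B` (`B·[C accepts the clique] ≤ B·[C accepts the negative]` coordinatewise),
then the legal local pair demanded by the leaf exists, at every locality `(r, s)`. [folklore] -/
theorem convWideCnf_of_rowDominated : ∀ (c m : ℕ) (φ : GateFn) (p q : ℕ)
    (A : Fin p → Matrix (Fin q) (Fin q) ℝ) (b : Fin p → ℝ) (B : Fin p → Fin φ.1 → ℝ),
    (∀ v : Fin φ.1 → Bool, φ.2 v = true ↔ ∃ Y : Matrix (Fin q) (Fin q) ℝ, Y.PosSemidef ∧
      ∀ i, (A i * Y).trace ≤ b i + ∑ j, B i j * (if v j then (1 : ℝ) else 0)) →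
    ∀ C : Fin φ.1 → Finset (Finset ((⊤ : SimpleGraph (Fin m)).edgeSet)),
    (#((((powersetCard (Fintype.card ((⊤ : SimpleGraph (Fin m)).edgeSet) / ⌊(m : ℝ) ^ (1 / 8 : ℝ)⌋₊)
        (univ : Finset ((⊤ : SimpleGraph (Fin m)).edgeSet))).image
          (fun M => fun e => decide (e ∉ M)))).filter fun y =>
        ¬ ∀ x ∈ posGraphs m ⌈(m : ℝ) ^ (1 / 4 : ℝ)⌉₊, ∀ i,
          ∑ j, B i j * (if decide (EvalCNF (C j) x) then (1 : ℝ) else 0) ≤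
            ∑ j, B i j * (if decide (EvalCNF (C j) y) then (1 : ℝ) else 0)) : ℝ) ≤
      (1 / (8 * (m : ℝ) ^ (c + 1))) *
        #(((powersetCard (Fintype.card ((⊤ : SimpleGraph (Fin m)).edgeSet) / ⌊(m : ℝ) ^ (1 / 8 : ℝ)⌋₊)
          (univ : Finset ((⊤ : SimpleGraph (Fin m)).edgeSet))).image (fun M => fun e => decide (e ∉ M)))) →
    ∀ r s : ℕ,
        ∃ dnf cnf : Finset (Finset ((⊤ : SimpleGraph (Fin m)).edgeSet)),
          (∀ R ∈ dnf, #R ≤ r - 1) ∧ (∀ S ∈ cnf, #S ≤ s - 1) ∧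
          (∀ x, EvalDNF dnf x → EvalCNF cnf x) ∧
          (#((posGraphs m ⌈(m : ℝ) ^ (1 / 4 : ℝ)⌉₊).filter
              (fun x => φ.2 (fun j => decide (EvalCNF (C j) x)) = true ∧ ¬ EvalDNF dnf x)) : ℝ)
            ≤ (1 / (8 * (m : ℝ) ^ (c + 1))) * #(posGraphs m ⌈(m : ℝ) ^ (1 / 4 : ℝ)⌉₊) ∧
          (#((((powersetCard (Fintype.card ((⊤ : SimpleGraph (Fin m)).edgeSet) / ⌊(m : ℝ) ^ (1 / 8 : ℝ)⌋₊)
          (univ : Finset ((⊤ : SimpleGraph (Fin m)).edgeSet))).image (fun M => fun e => decide (e ∉ M)))).filter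
              (fun x => EvalCNF cnf x ∧ φ.2 (fun j => decide (EvalCNF (C j) x)) = false)) : ℝ)
            ≤ (1 / (8 * (m : ℝ) ^ (c + 1))) *
              #(((powersetCard (Fintype.card ((⊤ : SimpleGraph (Fin m)).edgeSet) / ⌊(m : ℝ) ^ (1 / 8 : ℝ)⌋₊)
          (univ : Finset ((⊤ : SimpleGraph (Fin m)).edgeSet))).image (fun M => fun e => decide (e ∉ M)))) := by
  intro c m φ p q A b B hφ C hdom r s
  refine pair_of_rowDominated A b B φ.2 hφ (fun x j => decide (EvalCNF (C j) x))
    (posGraphs m ⌈(m : ℝ) ^ (1 / 4 : ℝ)⌉₊)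
    (((powersetCard (Fintype.card ((⊤ : SimpleGraph (Fin m)).edgeSet) / ⌊(m : ℝ) ^ (1 / 8 : ℝ)⌋₊)
      (univ : Finset ((⊤ : SimpleGraph (Fin m)).edgeSet))).image (fun M => fun e => decide (e ∉ M))))
    (ε := 1 / (8 * (m : ℝ) ^ (c + 1))) (by positivity) ?_ r s
  -- `convert`, not `exact`: the two `DecidablePred` instances of the filter differ syntactically
  convert hdom using 4

end Summit.PneNP.PneNP.Theorems.CliqueExtLowerBound.WidthThreshold.ConvRowCone

end
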